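import Mathlib.Analysis.Normed.Module.FiniteDimension
import Mathlib.Topology.UniformSpace.Ascoli
import Mathlib.Topology.UniformSpace.CompactConvergence
import Mathlib.Topology.MetricSpace.Equicontinuity
import HarnessLib

/-!
# Sequential Arzelà–Ascoli on open sets: equicontinuous, pointwise bounded sequences subconverge locally uniformly
(topic `Analysis/FunctionSpaces`; Arzelà–Ascoli in the sequential form used by compactness
theorems of analysis — Conway 1978, VII.1.23; Rudin, *Real and Complex Analysis*, Thm. 11.28;
Mathlib's abstract `ArzelaAscoli.isCompact_closure_of_isClosedEmbedding`)

**Theorem (`exists_strictMono_tendstoLocallyUniformlyOn_of_equicontinuousOn`).** Let `U` be an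
open subset of a finite-dimensional real normed space, `Y` a proper metric space (closed balls
compact), and `G : ℕ → E → Y` a sequence of maps which is EQUICONTINUOUS on `U` (as maps on the
subspace `U`) and POINTWISE BOUNDED on `U`. Then a subsequence converges locally uniformly on `U`
(equivalently: uniformly on compact subsets of `U`) to a map continuous on `U`.

This is the extraction step of every `Cᵏ` / Montel-type compactness theorem; the holomorphic case
with this exact proof is `Literature/Analysis/Complex/Montel.lean` (there equicontinuity comes
from Cauchy estimates; for `Cᵏ` families it comes from uniform `C^{k+1}` bounds,
`Literature/Analysis/Calculus/IteratedFDerivEquicontinuity.lean`).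

Proof: restrict to the locally compact, σ-compact subspace `U`; `C(U, Y) → (U →ᵤ[compacts] Y)` is
a closed embedding, so by Mathlib's `ArzelaAscoli.isCompact_closure_of_isClosedEmbedding` the
closure of the range of the sequence in `C(U, Y)` (compact-open topology) is compact; `C(U, Y)` is
first countable, so a subsequence converges, i.e. converges locally uniformly
(`ContinuousMap.tendsto_iff_tendstoLocallyUniformly`).

## References
* [Conway1978] J. B. Conway, *Functions of One Complex Variable*, 2nd ed., GTM 11, Springer 1978,
  Ch. VII, Thm. 1.23 (Arzelà–Ascoli).
-/

noncomputable section

open Set Metric Filter Topology Function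

namespace Literature.Analysis.FunctionSpaces

variable {E : Type*} [NormedAddCommGroup E] [NormedSpace ℝ E] [FiniteDimensional ℝ E]
  {Y : Type*} [MetricSpace Y] [ProperSpace Y]

/-- **Sequential Arzelà–Ascoli on an open set.** An equicontinuous (on the subspace `U`),
pointwise bounded sequence of maps into a proper metric space has a subsequence converging locally
uniformly on the open set `U` to a map continuous on `U`. [cite: Conway1978, Ch. VII Thm. 1.23] -/
theorem exists_strictMono_tendstoLocallyUniformlyOn_of_equicontinuous {U : Set E} (hU : IsOpen U)
    {G : ℕ → E → Y} (heq : Equicontinuous fun n ↦ U.restrict (G n))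
    (hb : ∀ x ∈ U, ∃ (y₀ : Y) (M : ℝ), ∀ n, dist (G n x) y₀ ≤ M) :
    ∃ (g : E → Y) (φ : ℕ → ℕ), StrictMono φ ∧ ContinuousOn g U ∧
      TendstoLocallyUniformlyOn (fun n ↦ G (φ n)) g atTop U := by
  classical
  haveI : LocallyCompactSpace U := hU.locallyCompactSpace
  rcases U.eq_empty_or_nonempty with hUe | hUne
  · refine ⟨G 0, id, strictMono_id, by simp [hUe], by simp [hUe, TendstoLocallyUniformlyOn]⟩
  obtain ⟨x₁, hx₁⟩ := hUne
  -- the restrictions to `U`, as elements of `C(U, Y)`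
  have hGc : ∀ n, Continuous (U.restrict (G n)) := fun n ↦ heq.continuous n
  obtain ⟨H, hH⟩ : ∃ H : ℕ → C(U, Y), ∀ n, ∀ x : U, H n x = G n x :=
    ⟨fun n ↦ ⟨U.restrict (G n), hGc n⟩, fun _ _ ↦ rfl⟩
  -- `C(U, Y) → (U →ᵤ[compacts] Y)` is a closed embedding (`U` is locally compact)
  have hce : IsClosedEmbedding
      (UniformOnFun.ofFun {K : Set U | IsCompact K} ∘ fun f : C(U, Y) ↦ (⇑f : U → Y)) := by
    refine ⟨ContinuousMap.isUniformEmbedding_toUniformOnFunIsCompact.isEmbedding, ?_⟩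
    change IsClosed (range (ContinuousMap.toUniformOnFunIsCompact : C(U, Y) → _))
    rw [ContinuousMap.range_toUniformOnFunIsCompact]
    exact UniformOnFun.isClosed_setOf_continuous CompactlyCoherentSpace.isCoherentWith
  -- the family `{H n}` is equicontinuous
  have heqH : Equicontinuous
      ((fun f : C(U, Y) ↦ (⇑f : U → Y)) ∘ ((↑) : range H → C(U, Y))) := by
    intro x₀
    have h0 := heq x₀
    rw [equicontinuousAt_iff_pair] at h0 ⊢
    intro V hV
    obtain ⟨W, hW, hWV⟩ := h0 V hV
    refine ⟨W, hW, fun x hx x' hx' ⟨_, n, rfl⟩ ↦ ?_⟩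
    show (H n x, H n x') ∈ V
    rw [hH, hH]
    exact hWV x hx x' hx' n
  -- pointwise boundedness
  have hpt : ∀ K ∈ {K : Set U | IsCompact K}, ∀ x ∈ K, ∃ Q : Set Y, IsCompact Q ∧
      ∀ i ∈ range H, (fun f : C(U, Y) ↦ (⇑f : U → Y)) i x ∈ Q := by
    intro K _ x _
    obtain ⟨y₀, M, hM⟩ := hb x x.2
    refine ⟨closedBall y₀ M, isCompact_closedBall _ _, ?_⟩
    rintro _ ⟨n, rfl⟩
    change H n x ∈ closedBall y₀ M
    rw [hH, mem_closedBall]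
    exact hM n
  have hcpt : IsCompact (closure (range H)) :=
    ArzelaAscoli.isCompact_closure_of_isClosedEmbedding (F := fun f : C(U, Y) ↦ (⇑f : U → Y))
      (fun K hK ↦ hK) hce (fun K _ ↦ heqH.equicontinuousOn K) hpt
  obtain ⟨g, -, φ, hφ, hlim⟩ :=
    hcpt.tendsto_subseq (x := H) fun n ↦ subset_closure (mem_range_self n)
  rw [ContinuousMap.tendsto_iff_tendstoLocallyUniformly] at hlim
  -- extend the limit by junk outside `U`
  let g' : E → Y := fun z ↦ if hz : z ∈ U then g ⟨z, hz⟩ else G 0 x₁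
  have hg' : (g' ∘ ((↑) : U → E)) = ⇑g := by
    funext x
    simp [g', x.2]
  refine ⟨g', φ, hφ, ?_, ?_⟩
  · rw [continuousOn_iff_continuous_restrict, show U.restrict g' = g' ∘ ((↑) : U → E) from rfl,
      hg']
    exact g.continuous
  · rw [tendstoLocallyUniformlyOn_iff_tendstoLocallyUniformly_comp_coe]
    have h1 : (fun i (x : U) ↦ G (φ i) (x : E)) = fun i a ↦ (H ∘ φ) i a := by
      funext i x
      simp [hH]
    rw [h1, hg']
    exact hlim

/-- The same with equicontinuity phrased through `EquicontinuousOn` (equicontinuity WITHIN `U`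
at points of `U`; for an open `U` this is the same as equicontinuity of the restrictions). [cite: Conway1978, Ch. VII Thm. 1.23] -/
theorem exists_strictMono_tendstoLocallyUniformlyOn_of_equicontinuousOn {U : Set E}
    (hU : IsOpen U) {G : ℕ → E → Y} (heq : EquicontinuousOn G U)
    (hb : ∀ x ∈ U, ∃ (y₀ : Y) (M : ℝ), ∀ n, dist (G n x) y₀ ≤ M) :
    ∃ (g : E → Y) (φ : ℕ → ℕ), StrictMono φ ∧ ContinuousOn g U ∧
      TendstoLocallyUniformlyOn (fun n ↦ G (φ n)) g atTop U :=
  exists_strictMono_tendstoLocallyUniformlyOn_of_equicontinuous hU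
    ((equicontinuous_restrict_iff _).2 heq) hb

end Literature.Analysis.FunctionSpaces
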